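import Summits.CriticalPhenomena.PercolationContinuityZ3.Theorems.PercNearOneGluingNoHeavyLowerTailStarSetChargingClassLevel
import Summits.CriticalPhenomena.PercolationContinuityZ3.Theorems.PercNearOneGluingNoHeavyLowerTailStarSetSupplyU1OfCharging
import Summits.CriticalPhenomena.PercolationContinuityZ3.Theorems.PercNearOneGluingNoHeavyLowerTailStarSetMixedU1
import HarnessLib

/-!
# `NoHeavyLowerTail` (stmt-CriticalPhenomena-4575) — U1′_r PROVED; OES at level `j ≤ 2` for every split two-port star multigraph

Support file (prover `prim-gen-swap` gen 15; `--supports stmt-CriticalPhenomena-4575`).  No definitions, no named facts, no sorries.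

The r-avoiding MWF supply inequality U1′_r (MWF-CERT.md §7; the hypothesis `hU1` of
`StarSet.setCS_twoPortStarMultigraph_mixed_levelTwo_of_U1`, p209479) holds for every two-port star multigraph presented as a forest in
leaf-peeling order plus locally dominated chords: `StarSet.mwf_supply_U1 := mwf_supply_U1_of_classLevel charging_classLevel …`
(the class-level theorem is moved to the `Fin` index types by `convert`, which reconciles the decidability instances).  Hence the
observer-extension inequality `μ(c ↮ S, 1 ≤ |π(S)| ≤ j) ≤ μ(c ↮ S, |π(c)| ≤ j)`, `j ≤ 2`, holds for every such system with NO supply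
hypothesis left: `StarSet.setCS_twoPortStarMultigraph_split_levelTwo`.

* `StarSet.mwf_supply_U1`, `StarSet.setCS_twoPortStarMultigraph_split_levelTwo`.
-/

noncomputable section

namespace Summit.CriticalPhenomena.PercolationContinuityZ3.Theorems

open MeasureTheory Set Finset Literature.Probability.LatticeModels Literature.Probability.Percolation
open scoped Classical BigOperators

variable {n m Mf Mc : ℕ}

namespace StarSet

/-- **U1′_r (MWF-CERT.md §7) for every split two-port star multigraph.** -/
theorem mwf_supply_U1
    (w : Sym2 (Fin n) → unitInterval) (s p p' : Fin m → Fin n)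
    (cls : Fin m → Fin (Mf + Mc)) (P P' : Fin (Mf + Mc) → Fin n) (hP : ∀ i, p i = P (cls i)) (hP' : ∀ i, p' i = P' (cls i))
    (hPP' : ∀ κ, P κ ≠ P' κ)
    (hnopar : ∀ I K : Fin (Mf + Mc), I ≠ K → ¬ ((P K = P I ∨ P K = P' I) ∧ (P' K = P I ∨ P' K = P' I)))
    (hforest : ∀ K I : Fin Mf, K < I → P' (Fin.castAdd Mc K) ≠ P (Fin.castAdd Mc I) ∧ P' (Fin.castAdd Mc K) ≠ P' (Fin.castAdd Mc I))
    (hdomF : ∀ K : Fin Mc, ∀ d : Fin n, (d = P (Fin.natAdd Mf K) ∨ d = P' (Fin.natAdd Mf K)) →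
      ∃ I : Fin Mf, (P (Fin.castAdd Mc I) = d ∨ P' (Fin.castAdd Mc I) = d) ∧
        (P (Fin.castAdd Mc I) ∉ ({P (Fin.natAdd Mf K), P' (Fin.natAdd Mf K)} : Finset (Fin n)) ∨
          P' (Fin.castAdd Mc I) ∉ ({P (Fin.natAdd Mf K), P' (Fin.natAdd Mf K)} : Finset (Fin n))) ∧
        ∏ i ∈ Finset.univ.filter (fun i => cls i = Fin.castAdd Mc I), (1 - (w s(s i, p i) : ℝ) * w s(s i, p' i)) ≤
          ∏ i ∈ Finset.univ.filter (fun i => cls i = Fin.natAdd Mf K), (1 - (w s(s i, p i) : ℝ) * w s(s i, p' i)))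
    (r : Fin n) :
    (∏ i, (if (w s(s i, p i) : ℝ) * w s(s i, p' i) < 1 then
          ((1 - (w s(s i, p i) : ℝ)) * (1 - w s(s i, p' i))) / (1 - (w s(s i, p i) : ℝ) * w s(s i, p' i)) else 0)) *
        (∑ I ∈ (Finset.univ : Finset (Fin Mf)).filter (fun I => P (Fin.castAdd Mc I) ≠ r),
            ((1 - ∏ i ∈ Finset.univ.filter (fun i => cls i = Fin.castAdd Mc I), (1 - (w s(s i, p i) : ℝ) * w s(s i, p' i))) *
          ∏ K ∈ Finset.univ.filter (· < I), ∏ i ∈ Finset.univ.filter (fun i => cls i = Fin.castAdd Mc K), (1 - (w s(s i, p i) : ℝ) * w s(s i, p' i))) +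
        ∑ K ∈ (Finset.univ : Finset (Fin Mc)).filter (fun K => P (Fin.natAdd Mf K) ≠ r ∧ P' (Fin.natAdd Mf K) ≠ r),
            ((1 - ∏ i ∈ Finset.univ.filter (fun i => cls i = Fin.natAdd Mf K), (1 - (w s(s i, p i) : ℝ) * w s(s i, p' i))) *
          ∏ κ' ∈ Finset.univ.filter (fun κ' => ¬ (P κ' = P (Fin.natAdd Mf K) ∨ P κ' = P' (Fin.natAdd Mf K) ∨
              P' κ' = P (Fin.natAdd Mf K) ∨ P' κ' = P' (Fin.natAdd Mf K))),
            ∏ i ∈ Finset.univ.filter (fun i => cls i = κ'), (1 - (w s(s i, p i) : ℝ) * w s(s i, p' i)))) ≤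
      (∏ i, (if (w s(s i, p i) : ℝ) * w s(s i, p' i) < 1 then
          ((1 - (w s(s i, p i) : ℝ)) * (1 - w s(s i, p' i))) / (1 - (w s(s i, p i) : ℝ) * w s(s i, p' i)) else 0)) +
      ∑ e ∈ (Finset.univ : Finset (Fin m → Fin 3)).filter (fun e =>
          r ∉ (Finset.univ.filter fun i => e i = 1).image p ∪ (Finset.univ.filter fun i => e i = 2).image p'),
        (if 3 ≤ ((Finset.univ.filter fun i => e i = 1).image p ∪ (Finset.univ.filter fun i => e i = 2).image p').card then
          ∏ i, (if (w s(s i, p i) : ℝ) * w s(s i, p' i) < 1 then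
            ((if e i = 1 then (w s(s i, p i) : ℝ) else 1 - w s(s i, p i)) *
              (if e i = 2 then (w s(s i, p' i) : ℝ) else 1 - w s(s i, p' i))) / (1 - (w s(s i, p i) : ℝ) * w s(s i, p' i))
          else if e i = 1 then 1 else 0) else 0)
    :=
  mwf_supply_U1_of_classLevel (fun P P' hPP' hinj r F hforest θ hθ0 hθ1 O hO0 Φ hO1 hO2 hΦ4 hΦsq dom hdom => by
      convert charging_classLevel P P' hPP' hinj r F hforest θ hθ0 hθ1 O hO0 Φ hO1 hO2 hΦ4 hΦsq dom hdom)
    w s p p' cls P P' hP hP' hPP' hnopar hforest hdomF r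

/-- **OES_{j≤2} for every two-port star multigraph = forest ⊔ locally dominated chords, unconditionally.**
[cite: VandenbergHaggstromKahn2005, Thm. 1.5 (p. 7) — via `observerSet_le_of_lonelier`] -/
theorem setCS_twoPortStarMultigraph_split_levelTwo (w : Sym2 (Fin n) → unitInterval) (A : Finset (Fin n)) (s p p' : Fin m → Fin n)
    (cls : Fin m → Fin (Mf + Mc)) (P P' : Fin (Mf + Mc) → Fin n) (hP : ∀ i, p i = P (cls i)) (hP' : ∀ i, p' i = P' (cls i))
    (c : Fin n) (j : ℕ) (hj : j ≤ 2) (hs : Function.Injective s) (hsA : ∀ i, s i ∉ A)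
    (hPA : ∀ I, P I ∈ A) (hP'A : ∀ I, P' I ∈ A) (hPP' : ∀ I, P I ≠ P' I)
    (hnopar : ∀ I K : Fin (Mf + Mc), I ≠ K → ¬ ((P K = P I ∨ P K = P' I) ∧ (P' K = P I ∨ P' K = P' I)))
    (hforest : ∀ K I : Fin Mf, K < I → P' (Fin.castAdd Mc K) ≠ P (Fin.castAdd Mc I) ∧ P' (Fin.castAdd Mc K) ≠ P' (Fin.castAdd Mc I))
    (hcA : c ∈ A) (hcP : ∀ I, c ≠ P I ∧ c ≠ P' I)
    (hobs : ∀ i u, u ≠ s i → u ≠ p i → u ≠ p' i → w s(s i, u) = 0)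
    (hdom : ∀ I,
      (prodBernoulli w).real {ω : BondConfig (Fin n) | (A.filter fun z => ω ∈ openConn (P I) z).card ≤ j} ≤
          (prodBernoulli w).real {ω : BondConfig (Fin n) | (A.filter fun z => ω ∈ openConn c z).card ≤ j} ∧
        (prodBernoulli w).real {ω : BondConfig (Fin n) | (A.filter fun z => ω ∈ openConn (P' I) z).card ≤ j} ≤
          (prodBernoulli w).real {ω : BondConfig (Fin n) | (A.filter fun z => ω ∈ openConn c z).card ≤ j})
    (hdomF : ∀ K : Fin Mc, ∀ d : Fin n, (d = P (Fin.natAdd Mf K) ∨ d = P' (Fin.natAdd Mf K)) →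
      ∃ I : Fin Mf, (P (Fin.castAdd Mc I) = d ∨ P' (Fin.castAdd Mc I) = d) ∧
        (P (Fin.castAdd Mc I) ∉ ({P (Fin.natAdd Mf K), P' (Fin.natAdd Mf K)} : Finset (Fin n)) ∨
          P' (Fin.castAdd Mc I) ∉ ({P (Fin.natAdd Mf K), P' (Fin.natAdd Mf K)} : Finset (Fin n))) ∧
        ∏ i ∈ Finset.univ.filter (fun i => cls i = Fin.castAdd Mc I), (1 - (w s(s i, p i) : ℝ) * w s(s i, p' i)) ≤
          ∏ i ∈ Finset.univ.filter (fun i => cls i = Fin.natAdd Mf K), (1 - (w s(s i, p i) : ℝ) * w s(s i, p' i))) :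
    (prodBernoulli w).real {ω : BondConfig (Fin n) | (∀ x ∈ Finset.univ.image s, ω ∉ openConn c x) ∧
        1 ≤ (A.filter fun z => ∃ x ∈ Finset.univ.image s, ω ∈ openConn x z).card ∧
        (A.filter fun z => ∃ x ∈ Finset.univ.image s, ω ∈ openConn x z).card ≤ j} ≤
      (prodBernoulli w).real {ω : BondConfig (Fin n) | (∀ x ∈ Finset.univ.image s, ω ∉ openConn c x) ∧
        (A.filter fun z => ω ∈ openConn c z).card ≤ j}
    :=
  setCS_twoPortStarMultigraph_mixed_levelTwo_of_U1 w A s p p' cls P P' hP hP' c j hj hs hsA hPA hP'A hPP' hnopar hforest hcA hcP hobs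
    hdom hdomF (fun r => mwf_supply_U1 w s p p' cls P P' hP hP' hPP' hnopar hforest hdomF r)

end StarSet

end Summit.CriticalPhenomena.PercolationContinuityZ3.Theorems

end
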